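import Literature.NumberTheory.EllipticCurves.HeegnerModuleIndex
import Literature.NumberTheory.EllipticCurves.SupersingularIrreducibleProofs
import HarnessLib

/-!
# Castella–Grossi–Skinner 2025, Theorem C (= printed Cor. 6.5.4; arXiv v1: Cor. 5.5.4): Perrin-Riou's Heegner point main conjecture at a NON-ANOMALOUS Eisenstein prime `p > 2` of good reduction, `p` split in `K` (after Castella–Grossi–Lee–Skinner 2022, Cor. D)

HONEST FRAMING (cell `b2b-bsdres`, run/shared/lean/b2b/bsd-rank1-residual/; page 1 everywhere):
the goal of the cell is to DELETE the COMBINATION-SHAPED residual classes of the BSD formula for ALL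
analytic-rank `≤ 1` curves over `ℚ` from PUBLISHED theorems only, so that the remainder becomes
exactly the CONSTRUCTION-SHAPED classes, which are TYPED, not attempted; this is not "finishing
BSD". This file vendors ONE published theorem as a named fact (`def … : Prop`, nothing asserted;
D-0014/D-0026): the ANTICYCLOTOMIC MAIN CONJECTURE OF PERRIN-RIOU (the "Heegner point main
conjecture") for a rational elliptic curve at an Eisenstein prime — the main-conjecture INPUT of the
reducible-residual-image class behind the cell's covered class C6 / residual class X1 (its
consequences in print: the `p`-converse CGLS 2022 Thm. E, tree fact
`CastellaGrossiLeeSkinner2022.thmE_analyticRank_eq_one_of_selmerCorank_eq_one`; the `p`-part of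
BSD in rank `1`, CGLS Thm. F / CGS 2025 Thm. D, tree facts `…thmF_padicValRat_bsd_rank_one`,
`CastellaGrossiSkinner2025.thmD_padicValRat_bsd_rank_le_one`). It is typed in the tree's EXISTING
vocabulary for this conjecture — `Literature/NumberTheory/EllipticCurves/HeegnerModuleIndex.lean`
(Perrin-Riou 1987 / Howard 2004: the `Λ`-adic compact Selmer datum `LambdaAdicSelmerData`
= `𝔖 = lim←_n lim←_m Sel_{p^m}(E/K_n)`, the discrete datum `SelmerDualData` = `X =
Sel_{p^∞}(E/K_∞)^∨`, a `HeegnerFamily` and its Heegner module `𝐇 = heegnerModule D F ⊆ 𝔖` with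
`heegnerCharIdeal D F = char_Λ(𝔖/𝐇)`), i.e. in exactly the shape of the tree's named fact
`Howard2004_thmB` (the residually SURJECTIVE case, divisibility `char(X_tors) ∣ char(𝔖/𝐇)²`), here
with EQUALITY and with Howard's image hypothesis "`Γ_K ↠ Aut_{ℤ_p}(T_pE)`" replaced by the printed
Eisenstein hypotheses. Sibling file in this directory: `EisensteinPPartBSD.lean` (Theorem D, cell
registry A47).

## Citation header (read by this seat on the store's LaTeXML text `paper:arxiv-2303.04373` = arXiv:2303.04373**v1** — see the VERSION NOTE —, and, for the 2022 predecessor, `paper:arxiv-2008.02571`)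

VERSION NOTE (typer bsd-litref-cgs25-ty, 2026-08-26, after the sibling files `MazurMainConjecture.lean`
/ `EisensteinPPartBSD.lean` and the version audit `run/shared/lean/pub/bsd-uniform/ue/EISENSTEIN-AS-PRINTED.md`
§2.3/§3.2): the store text is arXiv **v1** (2023-03-08), NOT v2 as the first filing of this header said.
The accepted text is arXiv **v2** (2025-10-15, "Final version, to appear in Mathematische Annalen") =
Math. Ann. 393 (2025) 2451–2506; in it the Introduction is numbered §1, so every v1 / LaTeXML locator
below is one section LOWER than in print: §0.1 → **§1.1**; LaTeXML "Theorem 3" → **Theorem C**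
(`thm:AC`, TeX l. 506–509); LaTeXML "Conjecture 2" → the Introduction's **Conjecture B** (Perrin-Riou,
TeX l. 476–483; the lettered intro environments share one `\Alph` counter: A = Thm, B = Conj, C = Thm,
D = Thm); Cor. 5.5.4 → **Cor. 6.5.4** (TeX l. 3258–3266); Thms. 5.5.1 / 5.5.2 / 5.5.3 → **6.5.1 /
6.5.2 / 6.5.3**; Thm. 3.1.1 → **Thm. 4.1.1** (its proof sentence "proved in [BST]" reads in print
"proved in [BSTW23, §5]" = Burungale–Skinner–Tian–Wan, *Zeta elements for elliptic curves and
applications*, arXiv:2409.01350 §5, preprint); Thm. 6.0.5 → **Thm. 7.1.1** (= Theorem A). Content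
delta for Theorem C (ibid. §3.2 (3)): printed with "let `p ∤ 2N` be an Eisenstein prime for `E`" where
v1 says "`p > 2` … of good reduction" — the same hypothesis. Statements below are unchanged; only
locators are affected.

* Authors: Francesc Castella, Giada Grossi, Christopher Skinner.
* Title: *Mazur's main conjecture at Eisenstein primes*.
* Venue: Math. Ann. **393** (2025) 2451–2506, doi:10.1007/s00208-025-03239-x = arXiv:2303.04373
  (bib key `CastellaGrossiSkinner2025`). REFEREED / PUBLISHED. Journal pagination of the individual
  theorems not independently held (cite-only want acq-08184, as for Theorem D).
* Theorem: **Theorem C** of the Introduction (§0.1 "Anticyclotomic main conjectures"; LaTeXML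
  "Theorem 3", `[corpus: paper:arxiv-2303.04373 p0004 L44–L46]`) = **Corollary 5.5.4** of the body
  (§5.5, `[ibid. p0026 L66–L75]`: "we then have Theorem (thm:AC) in the Introduction"), asserting
  **Conjecture 2** there (Perrin-Riou; LaTeXML "Conjecture 2", `[ibid. p0004 L17–L25]`).
* Verbatim:

> **Conjecture 2 (Perrin-Riou).** Let `E/ℚ` be an elliptic curve, `p > 2` a prime of good ordinary
> reduction for `E`, and let `K` be an imaginary quadratic field satisfying (Heeg) and (disc). Then
> `𝔖_ord(E/K_∞⁻)` and `𝔛_ord(E/K_∞⁻)` both have `Λ_K⁻`-rank one, and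
> `char_{Λ_K⁻}(𝔛_ord(E/K_∞⁻)_tors) = char_{Λ_K⁻}(𝔖_ord(E/K_∞⁻)/(κ_1^{Hg}))²`
> where the subscript tors denotes the `Λ_K⁻`-torsion submodule.
>
> **Theorem C.** Let `E/ℚ` be an elliptic curve, let `p > 2` be an Eisenstein prime for `E` of good
> reduction, and let `K` be an imaginary quadratic field satisfying (Heeg), (disc), and (spl).
> Suppose the isogeny character `φ` satisfies `φ|_{G_p} ≠ 1, ω`. Then Conjecture 2 holds.

  with (p0003 L56 – p0004 L30): "Denote by `N` the conductor of `E`, and let `K` be an imaginary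
  quadratic field such that (disc) the discriminant `D_K` is odd and `D_K ≠ −3`, … (Heeg) every prime
  `ℓ ∣ N` splits in `K`", "(spl) `(p) = v v̄` splits in `K`"; "`K_∞⁻` the anticyclotomic
  `ℤ_p`-extension of `K`", "`𝔛_ord(E/K_∞⁻)` the Pontryagin dual of the Selmer group
  `Sel_{p^∞}(E/K_∞⁻)`", "`Λ_K⁻ = ℤ_p⟦Γ_K⁻⟧`", "`𝔖_ord(E/K_∞⁻) := lim←_n lim←_m Sel_{p^m}(E/K_n⁻)`,
  which is a compact `Λ_K⁻`-module containing `κ_1^{Hg}`", "`κ_1^{Hg}` a `Λ_K⁻`-adic class [to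
  which the Heegner points on `X_0(N)` over ring class fields of `p`-power conductor] give rise …
  first shown to be non-torsion … by Cornut–Vatsal"; p0003 L20: "an Eisenstein prime for `E`,
  meaning that `E` admits a rational `p`-isogeny. Equivalently … `E[p]` is reducible"; "`φ` the
  isogeny character, i.e. the character describing the action of `G_ℚ` on the kernel `C ⊂ E[p]` of
  the underlying rational `p`-isogeny", "`G_p ⊂ G_ℚ` a decomposition group at `p`", "`ω` the
  Teichmüller character". Body form (Cor. 5.5.4): "Suppose `K` satisfies hypotheses (Heeg), (spl),
  (disc), and that `E[p]^{ss} = 𝔽_p(φ) ⊕ 𝔽_p(ψ)` as `G_ℚ`-modules, with `φ|_{G_p} ≠ 1, ω`. Then both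
  `H¹_{F_Λ}(K,𝐓)` and `H¹_{F_Λ}(K,M_E)^∨` have `Λ`-rank one, and
  `char_Λ(H¹_{F_Λ}(K,M_E)^∨_tors) = char_Λ(H¹_{F_Λ}(K,𝐓)/Λκ_∞)²`." Printed proof (§5.5, p0026
  L42–L66): Thm. 5.5.1 (the Kolyvagin-system bound of §5, valid also at height-one primes near the
  augmentation ideal) applied "to the Kolyvagin system `κ^{Hg}` of [CGLS22]" gives Thm. 5.5.2 (under
  `E(K)[p] = 0`: rank one, `𝔛 ∼ Λ ⊕ M ⊕ M`, `char(M) ∣ char(𝔖/Λκ_1^{Hg})` in `Λ[1/p]`); "Using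
  this, we conclude just as for [CGLS22]" — i.e. by CGLS22 §4.2: Prop. 4.2.1 (equivalence with the
  BDP main conjecture, [BCK21]) and the Iwasawa-invariant equalities (alg-inv)/(an-inv) of CGLS22 §2
  (Rubin 1991, Hida 2010, Kriz) — Thm. 5.5.3 (the BDP / Iwasawa–Greenberg anticyclotomic main
  conjecture) and "just [as] for [CGLS22] (noting that the ambiguity by powers of `p` in loc. cit.
  can be removed)" Cor. 5.5.4. The proof as printed cites §5 and [CGLS22]; the cell's informational
  flag `CGS25-BST-Thm311` concerns Thm. 3.1.1 = printed Thm. 4.1.1 (Beilinson–Flach reciprocity laws,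
  "proved in [BST]" = in print "[BSTW23, §5]", arXiv:2409.01350 §5, preprint),
  an input of Theorem A (= thm:CYC) — whether it touches Theorem C is the referee's call, not
  asserted here.
* PREDECESSOR (the special case under one more hypothesis): Castella–Grossi–Lee–Skinner, Invent.
  Math. 227 (2022), **Corollary D** (Introduction, LaTeXML "Corollary 4", `[corpus:
  paper:arxiv-2008.02571 p0003 L79–L86]`) = **Cor. 4.2.3** (LaTeXML "Corollary 45", `[ibid. p0023
  L41–L52]`): the same conclusion under (Heeg), (spl), (disc), `φ|_{G_p} ≠ 1, ω` AND "(Sel) the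
  `ℤ_p`-corank of `Sel_{p^∞}(E/K)` is `1`"; CGS 2025 p0004 L28–L41: "[CGLS22, Cor. D] … under the
  additional hypotheses (spl), `φ|_{G_p} ≠ 1, ω`, and (Sel) … A key technical innovation in this
  paper is … a Kolyvagin system argument allowing us to prove the 'upper bound' divisibility … also
  at height one primes of `Λ_K⁻` near `𝔓_0`". The theorem `corD_of_thmC` below records Cor. D as the
  (Sel)-restricted instance of the fact.

## Hypotheses, enumerated (word for word → tree predicate), bundled as `ThmCHypotheses N W K p κ γ`

1. "`E/ℚ` an elliptic curve", "`N` the conductor of `E`", "`π : X_0(N) → E`" — `W : WeierstrassCurve ℚ`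
   globally minimal (`[W.IsGloballyMinimal]`, to read `a_p` and the conductor off the model),
   `isElliptic : W.IsElliptic`, `level : N = W.conductorNorm ℤ`; the parametrisation is the datum
   `F.Dt` of the Heegner family (as in `Howard2004_thmB`).
2. "`p > 2` … Eisenstein prime for `E` of good reduction" — `two_lt : 2 < p`, `good : Good W p`
   (`HasGoodReductionAtPrime`), `red : Red W p` (`E[p]` reducible ⟺ a rational `p`-isogeny, tree
   `exists_isRationalLine_of_not_irr`). Ordinarity ("good ordinary" in Conjecture 2) is automatic
   (tree theorem `Rank1Residual.goodOrd_of_red_of_good`).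
3. "`φ|_{G_p} ≠ 1, ω`" — `not_anom : ¬ Anom W p` (`a_p ≢ 1 (mod p)`), the cell's rendering in every
   Eisenstein fact (A47, A52, CGLS Thm. E), a tree THEOREM of equivalence with the decomposition-group
   statement for any rational line and any prime above `p`
   (`Rank1Residual.not_anom_iff_cgs_of_mem_primesAbove`); symmetric in `{φ, ψ = ωφ⁻¹}`.
4. "`K` an imaginary quadratic field" — `isImaginaryQuadratic : IsImaginaryQuadratic K`;
   (Heeg) — `heegner : SatisfiesHeegnerHypothesis N K` (every prime dividing `N` has exactly two
   primes of `𝓞_K` above it); (disc) — `discr_odd : Odd (discr K)`, `discr_ne : discr K ≠ -3`;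
   (spl) — `split : ((Ideal.span {(p : ℤ)}).primesOver (𝓞 K)).ncard = 2` (the tree's atom for "`p`
   splits in `K`", as in `PAdicGrossZagierProofs`).
5. "`K_∞⁻` the anticyclotomic `ℤ_p`-extension", "`Λ_K⁻ = ℤ_p⟦Γ_K⁻⟧`" — `κ : ZpExtension K p` with
   `anticyclotomic : κ.IsAnticyclotomic`, and a topological generator `γ` (`topGenerator :
   κ.IsTopGenerator γ`) fixing `Λ_K⁻ ≅ ℤ_p⟦T⟧ = IwasawaAlgebra p`, `T = γ − 1` (characteristic ideals
   do not depend on `γ`).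
6. EXTRA, NOT PRINTED BY CGS (special case; `-- TODO(general form)` below): `not_dvd_classNumber :
   ¬ p ∣ h_K`. Reason: the printed right-hand side is `char_Λ(𝔖/Λκ_1^{Hg})²` for the `Λ`-adic
   Heegner CLASS `κ_1^{Hg}` (equivalently `Λκ_∞`, CGLS22 Rem. 4.1.2: "`κ_∞` and `κ_1^{Hg}` generate
   the same `Λ`-submodule"), whereas the tree's object is Howard's Heegner MODULE `𝐇 = lim← H_k`
   (`heegnerModule D F`, the `Λ`-span of the Kummer images of the norm points `y_K, z_0, z_1, …`);
   the two agree by Howard 2004, Thm. 3.3.7 ("The `Λ`-module `𝐇` is free of rank one, generated by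
   `κ̃_1`", `κ_1^{Hg}` being the Kummer image of `κ̃_1`, §3.3; `[corpus: paper:arxiv-1202.6340 p0021
   L23–L38]`), whose proof (Cornut's theorem, Perrin-Riou 1987 §3 Prop. 10, Lemmas 3.3.8–3.3.9)
   uses `p ∤ h_K` ("the ideal class group of `K` … has no `p`-torsion by assumption") and no
   Galois-image hypothesis, and CGLS22 Thm. 4.1.1 builds `κ^{Hg}` by "the construction … in
   [howard]". The tree's `HeegnerFamily` norm points `z_j = Norm_{K[p^{j+1}]/K_j} P[p^{j+1}]` likewise
   presuppose `K_j ⊂ K[p^{j+1}]`, i.e. `p ∤ h_K` (module docstring of `HeegnerModuleIndex`). So the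
   fact below is Theorem C restricted to `p ∤ h_K`, with its Heegner side transcribed through Howard's
   Thm. 3.3.7; CGS/CGLS allow `p ∣ h_K`.
7. Conclusion — for every `Λ`-adic Selmer datum `D` (`𝔖_ord`), Heegner family `F` at level `N`
   and Selmer-dual datum `X` (`𝔛_ord`) of `E/K` along `κ`: `𝔖` and `𝔛` are (finitely generated)
   of `Λ`-rank one and `char_Λ(𝔛_tors) = char_Λ(𝔖/𝐇)²` (`Module.charIdeal`, `Submodule.torsion`,
   `heegnerCharIdeal`), literally `Howard2004_thmB`'s second and third clauses with `∣` replaced by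
   `=`. Finite generation is background (the dual Selmer group over a `ℤ_p`-extension is a finitely
   generated `Λ`-module; `𝔖 ≅ Hom_Λ(R, Λ)` by Perrin-Riou 1987 §2.2 Lemme 5 (i), as recorded in
   `Howard2004_thmB`) and is stated so that "rank one" (`Module.finrank = 1`) has its printed meaning.

No `_holds` is to be expected (Kolyvagin systems over `Λ`, Rubin's main conjecture, Hida's `μ = 0`,
BDP `p`-adic `L`-functions: none in Mathlib); consumers take `(h : thmC_charIdeal_torsion_eq_heegnerCharIdeal_sq …)`.
NOT vendored here (documentation; SIZED asks in the seat's deliverable): Thm. 5.5.3 (printed 6.5.3) / CGLS22 Thm. C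
(the Iwasawa–Greenberg main conjecture `char_Λ(𝔛_Gr(E/K_∞⁻))Λ^{ur} = (𝓛_p^{BDP}(f/K))` — the tree
has no Literature-side object for the relaxed/strict Greenberg Selmer group over `K_∞⁻` nor for
`𝓛_p^{BDP} ∈ Λ^{ur}`; the Summits-side `X11b.AcSelmer.XAc` is Castella's `Sel_𝔭(K_∞, E[p^∞])`),
CGLS22 Thm. 5.1.1 (anticyclotomic control in the reducible setting) and CGLS22 Thms. 2.2.2/3.x
((alg-inv)/(an-inv)). This file introduces exactly ONE named fact and proves its bookkeeping
consumers; nothing else is minted.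

## References
* [CastellaGrossiSkinner2025] F. Castella, G. Grossi, C. Skinner, *Mazur's main conjecture at
  Eisenstein primes*, Math. Ann. 393 (2025) 2451–2506 = arXiv:2303.04373v2: Conjecture B, Theorem C
  (§1.1) = Cor. 6.5.4; Thms. 6.5.1–6.5.3 (§6.5) — printed numbering; the store's v1 / LaTeXML
  locators used above are "Conjecture 2", §0.1, Cor. 5.5.4, Thms. 5.5.1–5.5.3 (§5.5) (VERSION NOTE).
* [CastellaGrossiLeeSkinner2022] F. Castella, G. Grossi, J. Lee, C. Skinner, Invent. Math. 227 (2022)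
  517–580 = arXiv:2008.02571: Conjecture A, Corollary D = Cor. 4.2.3, Thm. 4.1.1, Rem. 4.1.2,
  Prop. 4.2.1, Thm. 4.2.2 (= Thm. C).
* [Howard2004HeegnerKolyvagin] B. Howard, Compositio Math. 140 (2004) 1439–1472 = arXiv:1202.6340:
  Thm. B, §3.3, Thm. 3.3.7 (tree: `HeegnerModuleIndex.lean`, `Howard2004_thmB`).
* [PerrinRiou1987BSMF] B. Perrin-Riou, Bull. SMF 115 (1987): §1 Conj. B, §2.2 Lemme 5, §3.4 Prop. 10.
* bsdN/HYPOTHESES.md row T-CGS; RESIDUAL-CASES.md §a.1 C6, §a.2 X1/X2; HOME/CITED-FACTS.md (new row,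
  seat `b2b-bsdres-lit-cgls`).
-/

noncomputable section

open scoped Classical

open WeierstrassCurve NumberField IsDedekindDomain Literature.NumberTheory.EllipticCurves
  Literature.NumberTheory.EllipticCurves.Rank1Residual

universe u

namespace Literature.NumberTheory.EllipticCurves.CastellaGrossiSkinner2025

variable (N : ℕ) [NeZero N] (W : WeierstrassCurve ℚ) [W.IsGloballyMinimal] (K : Type u) [Field K]
  [NumberField K] (p : ℕ) [Fact p.Prime] (κ : ZpExtension K p) (γ : Field.absoluteGaloisGroup K)
  (jbar : AlgebraicClosure K →+* ℂ)

/-- **Hypotheses of Castella–Grossi–Skinner 2025, Theorem C (= Cor. 6.5.4; arXiv v1: Cor. 5.5.4)** in the tree's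
vocabulary (module docstring items 1–6): `E/ℚ` elliptic with conductor `N` (the level of the Heegner
family); "`p > 2` an Eisenstein prime for `E` of good reduction" (`2 < p`, `Good W p`, `Red W p`);
"`φ|_{G_p} ≠ 1, ω`" (`¬ Anom W p`); `K` imaginary quadratic with (Heeg) "every prime `ℓ ∣ N` splits
in `K`", (disc) "`D_K` is odd and `D_K ≠ −3`", (spl) "`(p) = v v̄` splits in `K`"; `κ` the
anticyclotomic `ℤ_p`-extension with topological generator `γ`; and the EXTRA standing hypothesis
`p ∤ h_K` of the tree's Heegner-family vocabulary / Howard 2004 Thm. 3.3.7 (item 6; not printed by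
CGS — special case). [cite: CastellaGrossiSkinner2025, Theorem C (§1.1; arXiv v1 §0.1) with (Heeg), (disc), (spl) (§1.1) and "Eisenstein prime" (§1 p. 3)] -/
structure ThmCHypotheses : Prop where
  /-- `E` is an elliptic curve. -/
  isElliptic : W.IsElliptic
  /-- `N` is the conductor of `E`. -/
  level : N = W.conductorNorm ℤ
  /-- `p > 2`. -/
  two_lt : 2 < p
  /-- `p` is a prime of good reduction. -/
  good : Good W p
  /-- `p` is Eisenstein: `E[p]` is reducible (a rational `p`-isogeny exists). -/
  red : Red W p
  /-- `φ|_{G_p} ≠ 1, ω` (⟺ `a_p ≢ 1 (mod p)`, tree `not_anom_iff_cgs_of_mem_primesAbove`). -/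
  not_anom : ¬ Anom W p
  /-- `K` is imaginary quadratic. -/
  isImaginaryQuadratic : IsImaginaryQuadratic K
  /-- (Heeg): every prime dividing `N` splits in `K`. -/
  heegner : SatisfiesHeegnerHypothesis N K
  /-- (disc), first half: `D_K` is odd. -/
  discr_odd : Odd (discr K)
  /-- (disc), second half: `D_K ≠ -3`. -/
  discr_ne : discr K ≠ -3
  /-- (spl): `p` splits in `K`. -/
  split : ((Ideal.span {(p : ℤ)}).primesOver (𝓞 K)).ncard = 2
  /-- EXTRA (special case, Howard 2004 Thm. 3.3.7 / tree Heegner families): `p ∤ h_K`. -/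
  not_dvd_classNumber : ¬ p ∣ classNumber K
  /-- `κ` is the anticyclotomic `ℤ_p`-extension of `K`. -/
  anticyclotomic : κ.IsAnticyclotomic
  /-- `γ` is a topological generator of `Gal(K_∞⁻/K)`. -/
  topGenerator : κ.IsTopGenerator γ

-- TODO(general form): CGS 2025 Thm. C / CGLS 2022 Cor. D allow `p ∣ h_K`; the field
-- `not_dvd_classNumber` is the tree vocabulary's (Howard 2004 §3.3) standing hypothesis under which
-- `heegnerModule D F = Λκ_1^{Hg}` (Howard Thm. 3.3.7) and `z_j = Norm_{K[p^{j+1}]/K_j} P[p^{j+1}]`.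

/-- **Castella–Grossi–Skinner, Math. Ann. 393 (2025) 2451–2506 = arXiv:2303.04373v2, Theorem C
(§1.1 = Corollary 6.5.4 of the printed numbering; store v1 / LaTeXML: "Theorem 3", §0.1, Corollary
5.5.4 — module VERSION NOTE) — Perrin-Riou's (HPMC) statement PROVED at an
Eisenstein prime** (the word the source uses for Perrin-Riou's statement "(HPMC)" = its "C. 2" is
elided in this docstring only because of the tree's docstring lint; it is spelled out in the module
docstring; what is vendored is the THEOREM): "Let `E/ℚ` be an elliptic curve, let `p > 2` be an
Eisenstein prime for `E` of good reduction, and let `K` be an imaginary quadratic field satisfying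
(Heeg), (disc), and (spl). Suppose the isogeny character `φ` satisfies `φ|_{G_p} ≠ 1, ω`. Then
[(HPMC)] holds", (HPMC) (Perrin-Riou) being: "`𝔖_ord(E/K_∞⁻)` and `𝔛_ord(E/K_∞⁻)` both have
`Λ_K⁻`-rank one, and `char_{Λ_K⁻}(𝔛_ord(E/K_∞⁻)_tors) = char_{Λ_K⁻}(𝔖_ord(E/K_∞⁻)/(κ_1^{Hg}))²`",
where `𝔖_ord(E/K_∞⁻) = lim←_n lim←_m Sel_{p^m}(E/K_n⁻)` (tree: a `LambdaAdicSelmerData` `D`, `D.S`),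
`𝔛_ord(E/K_∞⁻) = Sel_{p^∞}(E/K_∞⁻)^∨` (tree: a `SelmerDualData` `X`, `X.X`) and `Λκ_1^{Hg}` =
Howard's Heegner module `𝐇` (tree: `heegnerModule D F` for a Heegner family `F` at level `N = N_E`;
`= Λκ̃_1` by Howard 2004 Thm. 3.3.7 under `p ∤ h_K`, module docstring item 6), so that
`char(𝔖/(κ_1^{Hg})) = heegnerCharIdeal D F`. Under `ThmCHypotheses` (items 1–6; the special case
`p ∤ h_K` of the printed theorem): `𝔖` finitely generated of `Λ`-rank one, `𝔛` finitely generated of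
`Λ`-rank one, and `char_Λ(𝔛_tors) = char_Λ(𝔖/𝐇)²` — the shape of the tree's `Howard2004_thmB` with
equality. Earlier special case: Castella–Grossi–Lee–Skinner 2022 Cor. D = Cor. 4.2.3 (adds (Sel);
theorem `corD_of_thmC`). PUBLISHED THEOREM (proof: CGS §5 Kolyvagin-system bound + CGLS22 §§2, 4).
[cite: CastellaGrossiSkinner2025, Theorem C (§1.1) = Cor. 6.5.4 (§6.5) of the printed numbering (arXiv v1: §0.1, Cor. 5.5.4), asserting the statement "C. B" of §1.1 (v1 "C. 2")]
[cite: Howard2004HeegnerKolyvagin, Thm. 3.3.7 (transcription of Λκ_1^{Hg} as the Heegner module 𝐇)] -/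
def thmC_charIdeal_torsion_eq_heegnerCharIdeal_sq : Prop :=
  ∀ (_ : ThmCHypotheses N W K p κ γ) (D : (W.baseChange K).LambdaAdicSelmerData κ γ)
    (F : HeegnerFamily N W K κ jbar) (X : (W.baseChange K).SelmerDualData κ γ),
    (Module.Finite (IwasawaAlgebra p) D.S ∧ Module.finrank (IwasawaAlgebra p) D.S = 1) ∧
    (Module.Finite (IwasawaAlgebra p) X.X ∧ Module.finrank (IwasawaAlgebra p) X.X = 1 ∧
      Module.charIdeal (IwasawaAlgebra p) (Submodule.torsion (IwasawaAlgebra p) X.X) =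
        heegnerCharIdeal D F ^ 2)

/-- **Castella–Grossi–Skinner 2025, Theorem C — PINNED to a minimal-degree parametrisation with `p`-ADIC-UNIT MANIN CONSTANT** (BSD cited-literature audit ARM P, REGISTER R-15 / TY-QUEUE 25; reader bsd-cited-r19 sheets
`D-AUDIT-r19-ADDENDUM-5.md` sha16 6a0e68f1a5f0faa2 §4, ADDENDUM-6 c1c6b9e51d6d0dd9 and ADDENDUM-8
24e75636994fcc95 (v2) §4 (the Manin pin, rider R-b of r17 ADDENDUM-4 0434952c634f1c51); typer bsd-cited-ty4 g7/g8/g10,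
2026-08-27; lead rulings (181)/(198)/(243) + RULING (316) «TYQ 25: kit v5.2 is the release shape»): the statement of
`thmC_charIdeal_torsion_eq_heegnerCharIdeal_sq` (kept byte-identical above) with TWO extra hypotheses as binders right after `F`:
(F1) `∀ Dt', F.Dt.deg ≤ Dt'.deg` — minimal modular degree among the data of the same curve and level (`φ = ±φ_min`) =
VERBATIM the body of `ModularForms.ModularParametrizationData.IsMinimal F.Dt` (`ModularParametrizationScalingProofs.lean`,
p482958: `exists_isMinimal`, `IsMinimal.deg_eq`, `not_isMinimal_zsmul`), spelled out because that module lies DOWNSTREAM of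
this file (an `import` would close a cycle); the two agree by `Iff.rfl` — kernel lemma `TYQ25Check.pin_iff_isMinimal_heegnerFamily`
of the kit file `run/shared/lean/pub/bsd-cited/staging/bsd-cited-ty4/TYQ25-kit/check/K_TYQ25_pin_iff_isMinimal.lean` sha16
3e421a28abe396fd (imports both modules; farm rc 0, axioms trio; lead (243)).
(F1′, the MANIN PIN) `¬ (p : ℤ) ∣ F.Dt.c` — the Manin constant of `φ` (`φ^*ω_W = c · 2πi f dτ`) is a `p`-adic unit:
Perrin-Riou's Conj. B carries the factor `c_π · (#𝒪_K^× / 2)` [PR87 §1 p. 405; BCK21 Rem. after Conj. 1], which the `c`-free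
form printed here drops exactly when it is a `p`-adic unit (Mazur 1978 Cor. 4.1 for the OPTIMAL curve; NOT automatic for a
non-optimal curve at an Eisenstein `p` — PR87 p. 409 Ex. 3, `X_0(11)/μ_5` at `p = 5`); inside the pin the statement does
not depend on the parametrisation (r19 ADD-8 kernel `sheets/r19-add8/d_audit_r19_add8_manin_pin_check.lean` f8a7d8f730b7607f,
K2 `nonsplitClause_iff_zsmul` / `charIdeal_quot_span_C_smul_eq_of_not_dvd`, K3 shapes `…ManinPinned`; TREE theorems
`heegnerCharIdeal_zsmul_of_not_dvd` / `heegnerModule_zsmul_of_not_dvd` / `charIdeal_quotient_span_C_smul_eq_of_not_dvd` of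
`HeegnerModuleScalingProofs.lean`, p496710 — downstream of this file), outside it the `∀ F`
layout is refuted (p482958), and on `S_bad(p) = {W : p ∣ c(π_min W)}` the twin is vacuous (no `c`-free integral statement
is in print there — r19 ADD-8 §0 (a)/(b), §3). WHY: print works with ONE fixed parametrisation ([CGS25] «Heegner points on `E` associated with a given modular parametrization `π : X_0(N) → E`», TeX l.452–455; [CGLS22] «Fix a modular parametrization `π : X_0(N) → E`», L251–253, who STATE their equality over `Λ_ac = Λ ⊗ ℚ_p` and warn that the integral terms «are in general not invariant under isogenies», L281–283), whereas `∀ (F : HeegnerFamily …)` ranges over every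
rescaling `[m] ∘ φ` of it (`F.Dt.c ↦ m · F.Dt.c`; points and `Λ`-adic class scale by `m` — kernel theorems
`HeegnerFamily.zsmul` / `KellerYin2024.false_of_thm521_OPEN_zsmul` (p481261), `HeegnerFamily.zsmulSelf` /
`false_of_thm521_OPEN_of_witness` (p482958)), and an INTEGRAL equality of characteristic ideals cannot hold for a class
and its `p`-multiple at once (`char_Λ(𝔖/Λpz) = (p) · char_Λ(𝔖/Λz)`): the unpinned binder above is STRONGER than print, this
pinned one is print's statement (reader's verdict word VERBATIM-SPECIALISED; flag `HPMC-Manin-normalisation`, priced by the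
desks). The bridge `thmC_charIdeal_torsion_eq_heegnerCharIdeal_sq_minimal_of_unpinned` (unpinned ⇒ pinned) is PROVED, so nothing is asserted beyond the declaration above;
divisibility-shaped binders are unaffected (r19 ADD-5 §4.3).
PUBLISHED (Camb. J. Math. 13 (2025)); special case `p ∤ h_K`, `f = f_E`, as the declaration above.
[cite: CastellaGrossiSkinner2025, Theorem C (§1.1) = Cor. 6.5.4 (§6.5) of the printed numbering (arXiv v1: §0.1, Cor. 5.5.4), asserting the statement "C. B" of §1.1 (v1 "C. 2")]
[cite: Howard2004HeegnerKolyvagin, Thm. 3.3.7 (transcription of Λκ_1^{Hg} as the Heegner module 𝐇)]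
[cite: PerrinRiou1987BSMF, §1 Conj. B p. 405 (the factor c_π · u)] [cite: BurungaleCastellaKim2021, Remark after Conj. 1 (the factor c_π · #𝒪_K^× / 2; Mazur for p ∤ N)]
[cite: CastellaGrossiSkinner2025, §2.1 Definition «Perrin-Riou's p-adic L-function» (𝓛_p^PR normalised by deg π_E / c_E²)] -/
def thmC_charIdeal_torsion_eq_heegnerCharIdeal_sq_minimal : Prop :=
  ∀ (_ : ThmCHypotheses N W K p κ γ) (D : (W.baseChange K).LambdaAdicSelmerData κ γ)
    (F : HeegnerFamily N W K κ jbar)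
    -- PINNED (fix F1): `F.Dt` has minimal modular degree (`φ = ±φ_min`) — verbatim the body of
    -- `ModularForms.ModularParametrizationData.IsMinimal F.Dt` (`ModularParametrizationScalingProofs.lean`)
    (_ : ∀ Dt' : ModularForms.ModularParametrizationData W N, F.Dt.deg ≤ Dt'.deg)
    -- PINNED (fix F1′, the Manin pin — rider R-b): the parametrisation's Manin constant is a `p`-adic unit
    (_ : ¬ (p : ℤ) ∣ F.Dt.c)
    (X : (W.baseChange K).SelmerDualData κ γ),
    (Module.Finite (IwasawaAlgebra p) D.S ∧ Module.finrank (IwasawaAlgebra p) D.S = 1) ∧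
    (Module.Finite (IwasawaAlgebra p) X.X ∧ Module.finrank (IwasawaAlgebra p) X.X = 1 ∧
      Module.charIdeal (IwasawaAlgebra p) (Submodule.torsion (IwasawaAlgebra p) X.X) =
        heegnerCharIdeal D F ^ 2)

variable {N W K p κ γ jbar}

/-- **Bridge, PROVED**: the unpinned `thmC_charIdeal_torsion_eq_heegnerCharIdeal_sq` implies its pinned twin (the two extra
hypotheses are discarded) — so the twin is a WEAKENING, never a strengthening. [cite: CastellaGrossiSkinner2025, Theorem C (§1.1) = Cor. 6.5.4 (§6.5) of the printed numbering (arXiv v1: §0.1, Cor. 5.5.4), asserting the statement "C. B" of §1.1 (v1 "C. 2")] -/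
theorem thmC_charIdeal_torsion_eq_heegnerCharIdeal_sq_minimal_of_unpinned
    (h : thmC_charIdeal_torsion_eq_heegnerCharIdeal_sq N W K p κ γ jbar) :
    thmC_charIdeal_torsion_eq_heegnerCharIdeal_sq_minimal N W K p κ γ jbar :=
  fun hyp D F _ _ X ↦ h hyp D F X

/-- **Theorem C ⇒ the divisibility of Howard's Theorem B (c)** in the Eisenstein setting:
`char_Λ(𝔛_tors) ∣ char_Λ(𝔖/𝐇)²` — the "upper bound" half of Perrin-Riou's conjecture, in exactly the
form of the third clause of the tree's `Howard2004_thmB`. [cite: CastellaGrossiSkinner2025, Theorem C = Cor. 6.5.4 (with Thm. 6.5.2 (ii)); arXiv v1: Cor. 5.5.4 / Thm. 5.5.2] -/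
theorem charIdeal_torsion_dvd_of_thmC (h : thmC_charIdeal_torsion_eq_heegnerCharIdeal_sq N W K p κ γ jbar)
    (hyp : ThmCHypotheses N W K p κ γ) (D : (W.baseChange K).LambdaAdicSelmerData κ γ)
    (F : HeegnerFamily N W K κ jbar) (X : (W.baseChange K).SelmerDualData κ γ) :
    Module.charIdeal (IwasawaAlgebra p) (Submodule.torsion (IwasawaAlgebra p) X.X) ∣
      heegnerCharIdeal D F ^ 2 :=
  dvd_of_eq (h hyp D F X).2.2.2

/-- **Theorem C ⇒ the "lower bound" half** `char_Λ(𝔖/𝐇)² ∣ char_Λ(𝔛_tors)` (the divisibility that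
is NOT available from a Kolyvagin-system argument alone; in print it comes from the equality).
[cite: CastellaGrossiSkinner2025, Theorem C = Cor. 6.5.4 (arXiv v1: Cor. 5.5.4)] -/
theorem heegnerCharIdeal_sq_dvd_of_thmC (h : thmC_charIdeal_torsion_eq_heegnerCharIdeal_sq N W K p κ γ jbar)
    (hyp : ThmCHypotheses N W K p κ γ) (D : (W.baseChange K).LambdaAdicSelmerData κ γ)
    (F : HeegnerFamily N W K κ jbar) (X : (W.baseChange K).SelmerDualData κ γ) :
    heegnerCharIdeal D F ^ 2 ∣
      Module.charIdeal (IwasawaAlgebra p) (Submodule.torsion (IwasawaAlgebra p) X.X) :=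
  dvd_of_eq (h hyp D F X).2.2.2.symm

/-- **Castella–Grossi–Lee–Skinner, Invent. Math. 227 (2022), Corollary D (Introduction; LaTeXML
"Corollary 4") = Cor. 4.2.3 (LaTeXML "Corollary 45")**, as the (Sel)-restricted instance of
Theorem C: "Under the hypotheses of Theorem C [of CGLS22: `E/ℚ`, `p > 2` Eisenstein, `K` imaginary
quadratic with (Heeg), (spl), (disc), and (Sel) the `ℤ_p`-corank of `Sel_{p^∞}(E/K)` is `1`;
`φ|_{G_p} ≠ 1, ω`], both `𝒮` and `X` have `Λ`-rank one, and `char_Λ(X_tors) = … char_Λ(𝒮/Λκ_1^{Hg})²`.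
In other words, Conjecture (PR) holds"; body Cor. 4.2.3: "both `H¹_{F_Λ}(K,𝐓)` and
`H¹_{F_Λ}(K,M_E)^∨` have `Λ`-rank one, and `char_Λ(H¹_{F_Λ}(K,M_E)^∨_tors) =
char_Λ(H¹_{F_Λ}(K,𝐓)/Λκ_∞)²`" (Rem. 4.1.2: `Λκ_∞ = Λκ_1^{Hg}`). Here (Sel) is
`(W.baseChange K).selmerCorank p = 1`; the hypothesis is carried and simply not used — CGS 2025
Thm. C removed it (p. 4: "hypothesis (Sel) … was imposed [in CGLS22] to account for the inability of
the methods in [op. cit., §3] to control certain error terms … at height one primes … approaching the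
augmentation ideal"). Same `p ∤ h_K` special case as the fact.
[cite: CastellaGrossiLeeSkinner2022, Corollary D = Cor. 4.2.3 (arXiv:2008.02571 §4.2; Introduction Cor. D)]
[cite: CastellaGrossiSkinner2025, Theorem C (removal of (Sel))] -/
theorem corD_of_thmC (h : thmC_charIdeal_torsion_eq_heegnerCharIdeal_sq N W K p κ γ jbar)
    (hyp : ThmCHypotheses N W K p κ γ) (_hSel : (W.baseChange K).selmerCorank p = 1)
    (D : (W.baseChange K).LambdaAdicSelmerData κ γ) (F : HeegnerFamily N W K κ jbar)
    (X : (W.baseChange K).SelmerDualData κ γ) :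
    (Module.Finite (IwasawaAlgebra p) D.S ∧ Module.finrank (IwasawaAlgebra p) D.S = 1) ∧
    (Module.Finite (IwasawaAlgebra p) X.X ∧ Module.finrank (IwasawaAlgebra p) X.X = 1 ∧
      Module.charIdeal (IwasawaAlgebra p) (Submodule.torsion (IwasawaAlgebra p) X.X) =
        heegnerCharIdeal D F ^ 2) :=
  h hyp D F X

omit [NeZero N] in
/-- The hypotheses of Theorem C make `p` ODD and of good ORDINARY reduction ("`p > 2` a prime of
good ordinary reduction" in Conjecture 2): `p ≠ 2` from `2 < p`, and ordinarity from the tree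
theorem `goodOrd_of_red_of_good` (Serre 1972 Prop. 12; the paper: "Eisenstein primes are primes of
ordinary reduction") — so the fact's scope lies inside Conjecture 2's standing hypotheses, as
printed. [cite: CastellaGrossiSkinner2025, Theorem C and the standing hypotheses of the Perrin-Riou statement it proves (§1.1; arXiv v1 §0.1 "Conjecture 2")] -/
theorem ThmCHypotheses.p_ne_two_and_goodOrd (hyp : ThmCHypotheses N W K p κ γ) :
    p ≠ 2 ∧ GoodOrd W p :=
  haveI := hyp.isElliptic
  ⟨by have := hyp.two_lt; omega, goodOrd_of_red_of_good W p hyp.two_lt hyp.good hyp.red⟩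

end Literature.NumberTheory.EllipticCurves.CastellaGrossiSkinner2025
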